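import Literature.MathematicalPhysics.KineticTheory.SiteChainConfinedDrift
import Literature.MathematicalPhysics.KineticTheory.ReyBelletThomas2002
import HarnessLib

/-!
# Site-inhomogeneous Langevin chains with confining potentials: transition kernels, Dynkin, semigroup

Topic `Literature/MathematicalPhysics/KineticTheory`, grouping namespace `…KineticTheory.HeatConduction`.
Twin, for the site-dependent chains `SiteChain` of `CellChain.lean`, of the kernel half of
`LangevinChainConfined.lean`: under `SiteChain.UniformlyConfining` the Langevin SDE
`dz = Y(z) dt + v_L dB^L + v_R dB^R` (`Y = P.langevinDrift N`, `v_b = √(2γT_b) ∂_{p_b}`; Cuneo–Eckmann–Hairer–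
Rey-Bellet 2018 eq. (2.2) for the network on the path graph with baths at both ends) is run through
the model-free pipeline (`sdeSolMap`, `sdeKernel`, `ConfinedDynkin`):

* `SiteChain.noiseVecL/R` (the bath directions `√(2γT_b) ∂_{p_b}`),
  `SiteChain.generator_eq_fderiv_langevinDrift_add`, `generator_eq_fderiv_add_half_noiseVec`,
  `sdeGenerator_langevinDrift_eq_generator` — the verbatim generator `SiteChain.generator` IS the SDE
  generator `Df·Y + ½(D²f[v_L,v_L] + D²f[v_R,v_R])` on `C²` functions (`N ≥ 1`, `γT_L, γT_R ≥ 0`);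
* `SiteChain.langevinSolMap`, `SiteChain.langevinKernel` — solution map and transition kernels
  `P_t(x, ·) = law(Φ_t(x, B))`; under `UniformlyConfining`: Markov, jointly measurable, `P_0 = id`,
  Chapman–Kolmogorov, Feller, and Dynkin's identity `P_t f - f = ∫₀ᵗ P_s(Lf) ds` on `C²_c`;
* `SiteChain.UniformlyConfining.semigroup : MarkovSemigroupFor (P.generator N T_L T_R)` — the package
  in the generic interface of `ReyBelletThomas2002.lean` (`N ≥ 1`, `T_L, T_R ≥ 0`), with the Feller
  property `continuous_act_semigroup`.

## References

* N. Cuneo, J.-P. Eckmann, M. Hairer, L. Rey-Bellet, Electron. J. Probab. **23** (2018) no. 55,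
  eq. (2.2)–(2.3), §3 eq. (3.2).
* R. Khasminskii, *Stochastic Stability of Differential Equations* (2nd ed., 2012), Thm 3.5.
* D. Revuz, M. Yor, *Continuous Martingales and Brownian Motion* (1999), Ch. VII §1.

## Design choices

* The semigroup is packaged as `MarkovSemigroupFor L` (generic in the generator), not as the
  `OscillatorChain`-typed `LangevinChainSemigroup`; the fields are the same.
* Bath directions get the names `noiseVecL/R` (`= bathVec N 0 √(2γT_L)`, `bathVec N (N-1) √(2γT_R)`).
* NOT here: Lyapunov / H2 estimates, invariant measures, uniqueness — this file is model-free glue.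
-/

noncomputable section

open MeasureTheory ProbabilityTheory Filter Topology Set Metric
open scoped NNReal ENNReal ContDiff

namespace Literature.MathematicalPhysics.KineticTheory.HeatConduction

open Literature.Probability.Process Literature.MathematicalPhysics.KineticTheory

variable {N : ℕ}

namespace SiteChain

variable (P : SiteChain)

/-! ### The generator as `Df·Y + ½ ∑_b D²f[v_b, v_b]` -/

/-- `L f = Y·∇f + γ ∑_i ([i=0] T_L + [i=N-1] T_R) ∂²_{p_i} f` for differentiable `f`.
[cite: CuneoEckmannHairerReyBellet2018, eq. (3.2)] -/
theorem generator_eq_fderiv_langevinDrift_add (N : ℕ) (T_L T_R : ℝ) {f : PhaseSpace N → ℝ}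
    (hf : Differentiable ℝ f) (x : PhaseSpace N) :
    P.generator N T_L T_R f x = fderiv ℝ f x (P.langevinDrift N x) +
      P.γ * ∑ i, ((if i.val = 0 then T_L else 0) + (if i.val = N - 1 then T_R else 0)) *
        partialP i (partialP i f) x := by
  rw [clm_apply_eq_sum]
  simp only [generator, langevinDrift, OscillatorChain.bathWeight, partialQ_eq_fderiv hf, partialP_eq_fderiv hf,
    smul_eq_mul, Finset.mul_sum, ← Finset.sum_add_distrib, unitQ_eq, unitP_eq]
  refine Finset.sum_congr rfl fun i _ => ?_
  split_ifs <;> ring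

/-- The left bath direction `v_L = √(2γT_L) ∂_{p_0}` of the site-dependent chain.
[cite: CuneoEckmannHairerReyBellet2018, eq. (2.2)] -/
def noiseVecL (N : ℕ) (T_L : ℝ) : PhaseSpace N := bathVec N 0 (Real.sqrt (2 * P.γ * T_L))

/-- The right bath direction `v_R = √(2γT_R) ∂_{p_{N-1}}` of the site-dependent chain.
[cite: CuneoEckmannHairerReyBellet2018, eq. (2.2)] -/
def noiseVecR (N : ℕ) (T_R : ℝ) : PhaseSpace N := bathVec N (N - 1) (Real.sqrt (2 * P.γ * T_R))

/-- **The generator in Taylor form**: for `N ≥ 1`, `γT_L, γT_R ≥ 0` and `f ∈ C²`,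
`L f(x) = Df(x)·Y(x) + ½ (D²f(x)[v_L, v_L] + D²f(x)[v_R, v_R])` with the noise vectors `noiseVecL/R`.
[cite: CuneoEckmannHairerReyBellet2018, eq. (3.2)] -/
theorem generator_eq_fderiv_add_half_noiseVec (hN : 0 < N) {T_L T_R : ℝ} (hL : 0 ≤ P.γ * T_L)
    (hR : 0 ≤ P.γ * T_R) {f : PhaseSpace N → ℝ} (hf : ContDiff ℝ 2 f) (x : PhaseSpace N) :
    P.generator N T_L T_R f x = fderiv ℝ f x (P.langevinDrift N x) +
      (1 / 2) * (fderiv ℝ (fderiv ℝ f) x (P.noiseVecL N T_L) (P.noiseVecL N T_L) +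
        fderiv ℝ (fderiv ℝ f) x (P.noiseVecR N T_R) (P.noiseVecR N T_R)) := by
  have hfd : Differentiable ℝ f := hf.differentiable (by norm_num)
  rw [P.generator_eq_fderiv_langevinDrift_add N T_L T_R hfd x]
  congr 1
  have hN1 : N - 1 < N := Nat.sub_lt hN one_pos
  unfold noiseVecL noiseVecR
  rw [bathVec_eq_smul_unitP hN, bathVec_eq_smul_unitP hN1]
  simp only [map_smul, smul_apply, smul_eq_mul, add_mul, Finset.sum_add_distrib,
    mul_add]
  rw [sum_ite_val_eq_mul hN, sum_ite_val_eq_mul hN1, ← partialP_partialP_eq_fderiv_fderiv hf,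
    ← partialP_partialP_eq_fderiv_fderiv hf]
  have h2L : Real.sqrt (2 * P.γ * T_L) * Real.sqrt (2 * P.γ * T_L) = 2 * P.γ * T_L :=
    Real.mul_self_sqrt (by linarith)
  have h2R : Real.sqrt (2 * P.γ * T_R) * Real.sqrt (2 * P.γ * T_R) = 2 * P.γ * T_R :=
    Real.mul_self_sqrt (by linarith)
  have e1 : Real.sqrt (2 * P.γ * T_L) * (Real.sqrt (2 * P.γ * T_L) *
      partialP ⟨0, hN⟩ (partialP ⟨0, hN⟩ f) x) = 2 * P.γ * T_L * partialP ⟨0, hN⟩ (partialP ⟨0, hN⟩ f) x := by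
    rw [← mul_assoc, h2L]
  have e2 : Real.sqrt (2 * P.γ * T_R) * (Real.sqrt (2 * P.γ * T_R) *
      partialP ⟨N - 1, hN1⟩ (partialP ⟨N - 1, hN1⟩ f) x) =
      2 * P.γ * T_R * partialP ⟨N - 1, hN1⟩ (partialP ⟨N - 1, hN1⟩ f) x := by
    rw [← mul_assoc, h2R]
  rw [e1, e2]
  ring

/-! ### The transition kernels -/

/-- **The solution map** `Φ_t(x, w)` of the Langevin SDE `dz = Y(z) dt + v_L dB^L + v_R dB^R` of the
site-dependent chain, driven by the pair of raw bath-noise paths `w` (the pathwise `drivenFlow` of the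
model-free pipeline). [cite: CuneoEckmannHairerReyBellet2018, eq. (2.2)] -/
def langevinSolMap (N : ℕ) (T_L T_R : ℝ) (t : ℝ) (x : PhaseSpace N) (w : WienerPair) : PhaseSpace N :=
  sdeSolMap (P.langevinDrift N) (P.noiseVecL N T_L) (P.noiseVecR N T_R) t x w

/-- **The transition kernels `P_t(x, ·) = law(Φ_t(x, B))`** of the site-dependent Langevin chain
(`B` the pair of independent bath Brownian motions), via `sdeKernel` of the model-free pipeline
(documented junk — the zero kernel — when the solution map is not measurable; never the case under
`UniformlyConfining`). [cite: CuneoEckmannHairerReyBellet2018, eq. (2.3)] -/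
def langevinKernel (N : ℕ) (T_L T_R : ℝ) (t : ℝ≥0) : Kernel (PhaseSpace N) (PhaseSpace N) :=
  sdeKernel (P.langevinDrift N) (P.noiseVecL N T_L) (P.noiseVecR N T_R) t

/-- The generator of the site-dependent chain IS the SDE generator of the pipeline on `C²` functions
(`N ≥ 1`, `γT_L, γT_R ≥ 0`). [cite: CuneoEckmannHairerReyBellet2018, §3 eq. (3.2)] -/
theorem sdeGenerator_langevinDrift_eq_generator (hN : 0 < N) {T_L T_R : ℝ} (hL : 0 ≤ P.γ * T_L)
    (hR : 0 ≤ P.γ * T_R) {f : PhaseSpace N → ℝ} (hf : ContDiff ℝ 2 f) :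
    sdeGenerator (P.langevinDrift N) (P.noiseVecL N T_L) (P.noiseVecR N T_R) f = P.generator N T_L T_R f := by
  funext y
  rw [sdeGenerator_def, P.generator_eq_fderiv_add_half_noiseVec hN hL hR hf y]

namespace UniformlyConfining

variable {P}

/-- The left bath direction lies in the noise subspace. [folklore] -/
theorem noiseVecL_mem_noise (hP : P.UniformlyConfining) (N : ℕ) (T_L : ℝ) :
    P.noiseVecL N T_L ∈ (hP.confinedDrift N).noise :=
  hP.bathVec_mem_noise N _ _

/-- The right bath direction lies in the noise subspace. [folklore] -/
theorem noiseVecR_mem_noise (hP : P.UniformlyConfining) (N : ℕ) (T_R : ℝ) :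
    P.noiseVecR N T_R ∈ (hP.confinedDrift N).noise :=
  hP.bathVec_mem_noise N _ _

/-- `P_t(x, ·)` is the law of the solution map driven by the Brownian pair (no junk).
[cite: CuneoEckmannHairerReyBellet2018, eq. (2.3)] -/
theorem langevinKernel_apply (hP : P.UniformlyConfining) (N : ℕ) (T_L T_R : ℝ) (t : ℝ≥0) (x : PhaseSpace N) :
    P.langevinKernel N T_L T_R t x =
      wienerPair.map fun w => P.langevinSolMap N T_L T_R t x (pairPath w) :=
  (hP.confinedDrift N).toConfinedDrift.sdeKernel_apply (hP.noiseVecL_mem_noise N T_L)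
    (hP.noiseVecR_mem_noise N T_R) t x

/-- `P^t g(x) = E g(Φ_t(x, B))` for measurable `g ≥ 0`. [folklore] -/
theorem lintegral_langevinKernel (hP : P.UniformlyConfining) (N : ℕ) (T_L T_R : ℝ) (t : ℝ≥0) (x : PhaseSpace N)
    {g : PhaseSpace N → ℝ≥0∞} (hg : Measurable g) :
    ∫⁻ y, g y ∂(P.langevinKernel N T_L T_R t x) =
      ∫⁻ w, g (P.langevinSolMap N T_L T_R t x (pairPath w)) ∂wienerPair :=
  (hP.confinedDrift N).toConfinedDrift.lintegral_sdeKernel (hP.noiseVecL_mem_noise N T_L)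
    (hP.noiseVecR_mem_noise N T_R) t x hg

/-- `P^t g(x) = E g(Φ_t(x, B))` for ae-strongly measurable real `g`. [folklore] -/
theorem integral_langevinKernel (hP : P.UniformlyConfining) (N : ℕ) (T_L T_R : ℝ) (t : ℝ≥0) (x : PhaseSpace N)
    {g : PhaseSpace N → ℝ} (hg : AEStronglyMeasurable g (P.langevinKernel N T_L T_R t x)) :
    ∫ y, g y ∂(P.langevinKernel N T_L T_R t x) =
      ∫ w, g (P.langevinSolMap N T_L T_R t x (pairPath w)) ∂wienerPair :=
  (hP.confinedDrift N).toConfinedDrift.integral_sdeKernel (hP.noiseVecL_mem_noise N T_L)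
    (hP.noiseVecR_mem_noise N T_R) t x hg

/-- **No explosion**: the transition kernels are Markov kernels. [folklore] -/
theorem isMarkovKernel_langevinKernel (hP : P.UniformlyConfining) (N : ℕ) (T_L T_R : ℝ) (t : ℝ≥0) :
    IsMarkovKernel (P.langevinKernel N T_L T_R t) :=
  (hP.confinedDrift N).toConfinedDrift.isMarkovKernel_sdeKernel (hP.noiseVecL_mem_noise N T_L)
    (hP.noiseVecR_mem_noise N T_R) t

/-- Joint measurability of `(t, x) ↦ P_t(x, ·)`. [folklore] -/
theorem measurable_langevinKernel (hP : P.UniformlyConfining) (N : ℕ) (T_L T_R : ℝ) :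
    Measurable fun p : ℝ≥0 × PhaseSpace N => P.langevinKernel N T_L T_R p.1 p.2 :=
  (hP.confinedDrift N).toConfinedDrift.measurable_sdeKernel (hP.noiseVecL_mem_noise N T_L)
    (hP.noiseVecR_mem_noise N T_R)

/-- `P_0 = id`. [folklore] -/
theorem langevinKernel_zero (hP : P.UniformlyConfining) (N : ℕ) (T_L T_R : ℝ) :
    P.langevinKernel N T_L T_R 0 = Kernel.id :=
  (hP.confinedDrift N).toConfinedDrift.sdeKernel_zero (hP.noiseVecL_mem_noise N T_L)
    (hP.noiseVecR_mem_noise N T_R)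

/-- **Chapman–Kolmogorov** `P_{s+t} = P_t ∘ₖ P_s`. [cite: CuneoEckmannHairerReyBellet2018, eq. (2.3)] -/
theorem langevinKernel_add (hP : P.UniformlyConfining) (N : ℕ) (T_L T_R : ℝ) (s t : ℝ≥0) :
    P.langevinKernel N T_L T_R (s + t) = P.langevinKernel N T_L T_R t ∘ₖ P.langevinKernel N T_L T_R s :=
  (hP.confinedDrift N).toConfinedDrift.sdeKernel_add (hP.noiseVecL_mem_noise N T_L)
    (hP.noiseVecR_mem_noise N T_R) s t

/-- **The Feller property**: `x ↦ P^t g(x)` is continuous for bounded continuous `g`. [folklore] -/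
theorem continuous_integral_langevinKernel (hP : P.UniformlyConfining) (N : ℕ) (T_L T_R : ℝ) (t : ℝ≥0)
    {g : PhaseSpace N → ℝ} (hg : Continuous g) {C : ℝ} (hC : ∀ y, ‖g y‖ ≤ C) :
    Continuous fun x => ∫ y, g y ∂(P.langevinKernel N T_L T_R t x) :=
  (hP.confinedDrift N).toConfinedDrift.continuous_integral_sdeKernel (hP.noiseVecL_mem_noise N T_L)
    (hP.noiseVecR_mem_noise N T_R) t hg hC

/-- The Feller property, `BoundedContinuousFunction` form. [folklore] -/
theorem continuous_integral_langevinKernel_bcf (hP : P.UniformlyConfining) (N : ℕ) (T_L T_R : ℝ) (t : ℝ≥0)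
    (g : BoundedContinuousFunction (PhaseSpace N) ℝ) :
    Continuous fun x => ∫ y, g y ∂(P.langevinKernel N T_L T_R t x) :=
  (hP.confinedDrift N).toConfinedDrift.continuous_integral_sdeKernel_bcf (hP.noiseVecL_mem_noise N T_L)
    (hP.noiseVecR_mem_noise N T_R) t g

/-- The solution map is continuous in time. [folklore] -/
theorem continuous_langevinSolMap (hP : P.UniformlyConfining) (N : ℕ) (T_L T_R : ℝ) (x : PhaseSpace N)
    (w : WienerPair) : Continuous fun t => P.langevinSolMap N T_L T_R t x w :=
  (hP.confinedDrift N).toConfinedDrift.continuous_sdeSolMap (hP.noiseVecL_mem_noise N T_L)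
    (hP.noiseVecR_mem_noise N T_R) x w

/-- The solution map is continuous in the initial condition. [folklore] -/
theorem continuous_langevinSolMap_left (hP : P.UniformlyConfining) (N : ℕ) (T_L T_R : ℝ) (t : ℝ)
    (w : WienerPair) : Continuous fun x => P.langevinSolMap N T_L T_R t x w :=
  (hP.confinedDrift N).toConfinedDrift.continuous_sdeSolMap_left (hP.noiseVecL_mem_noise N T_L)
    (hP.noiseVecR_mem_noise N T_R) t w

/-- The solution map driven by the Brownian pair is measurable for fixed `x`. [folklore] -/
theorem measurable_langevinSolMap_pairPath_right (hP : P.UniformlyConfining) (N : ℕ) (T_L T_R : ℝ) (t : ℝ)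
    (x : PhaseSpace N) : Measurable fun w : WienerPair => P.langevinSolMap N T_L T_R t x (pairPath w) :=
  (hP.confinedDrift N).toConfinedDrift.measurable_sdeSolMap_pairPath_right
    (hP.noiseVecL_mem_noise N T_L) (hP.noiseVecR_mem_noise N T_R) t x

/-- **Dynkin's identity on `C²_c`** for the Langevin kernels of a site-dependent chain:
`P_t f(z) - f(z) = ∫₀ᵗ P_s(Lf)(z) ds` with `L = P.generator N T_L T_R` (`N ≥ 1`, `T_L, T_R ≥ 0`).
[cite: CuneoEckmannHairerReyBellet2018, §3 eq. (3.2)] -/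
theorem langevinKernel_dynkin (hP : P.UniformlyConfining) (N : ℕ) (T_L T_R : ℝ) (hN : 0 < N) (hTL : 0 ≤ T_L)
    (hTR : 0 ≤ T_R) {f : PhaseSpace N → ℝ} (hf : ContDiff ℝ 2 f) (hf' : HasCompactSupport f) (t : ℝ≥0)
    (z : PhaseSpace N) :
    ∫ y, f y ∂(P.langevinKernel N T_L T_R t z) - f z =
      ∫ s in (0 : ℝ)..(t : ℝ), ∫ y, P.generator N T_L T_R f y
        ∂(P.langevinKernel N T_L T_R s.toNNReal z) := by
  have h := (hP.confinedDrift N).sdeKernel_dynkin (v₁ := P.noiseVecL N T_L) (v₂ := P.noiseVecR N T_R)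
    (hP.noiseVecL_mem_noise N T_L) (hP.noiseVecR_mem_noise N T_R) hf hf' t z
  rw [P.sdeGenerator_langevinDrift_eq_generator hN (mul_nonneg hP.γ_nonneg hTL)
    (mul_nonneg hP.γ_nonneg hTR) hf] at h
  exact h

/-! ### The transition semigroup -/

/-- **The transition semigroup of a site-dependent Langevin chain with confining potentials**
(`N ≥ 1`, `T_L, T_R ≥ 0`): the kernels `langevinKernel` form a `MarkovSemigroupFor (P.generator N T_L T_R)`
— Markov, `P_0 = id`, Chapman–Kolmogorov, jointly measurable, Dynkin's identity on `C_c^∞`.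
[cite: CuneoEckmannHairerReyBellet2018, eq. (2.3)] -/
def semigroup (hP : P.UniformlyConfining) (N : ℕ) (T_L T_R : ℝ) (hN : 0 < N) (hTL : 0 ≤ T_L) (hTR : 0 ≤ T_R) :
    MarkovSemigroupFor (P.generator N T_L T_R) where
  kernel := P.langevinKernel N T_L T_R
  isMarkovKernel := hP.isMarkovKernel_langevinKernel N T_L T_R
  kernel_zero := hP.langevinKernel_zero N T_L T_R
  kernel_add := hP.langevinKernel_add N T_L T_R
  measurable_kernel := hP.measurable_langevinKernel N T_L T_R
  dynkin := fun f hf hf' t z =>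
    hP.langevinKernel_dynkin N T_L T_R hN hTL hTR (hf.of_le (by norm_cast)) hf' t z

/-- The kernels of the semigroup are `langevinKernel`. [folklore] -/
@[simp] theorem semigroup_kernel (hP : P.UniformlyConfining) (N : ℕ) (T_L T_R : ℝ) (hN : 0 < N) (hTL : 0 ≤ T_L)
    (hTR : 0 ≤ T_R) (t : ℝ≥0) :
    (hP.semigroup N T_L T_R hN hTL hTR).kernel t = P.langevinKernel N T_L T_R t := rfl

/-- **The Feller property of the transition semigroup.** [folklore] -/
theorem continuous_act_semigroup (hP : P.UniformlyConfining) (N : ℕ) (T_L T_R : ℝ) (hN : 0 < N) (hTL : 0 ≤ T_L)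
    (hTR : 0 ≤ T_R) (t : ℝ≥0) (g : BoundedContinuousFunction (PhaseSpace N) ℝ) :
    Continuous ((hP.semigroup N T_L T_R hN hTL hTR).act t g) :=
  hP.continuous_integral_langevinKernel_bcf N T_L T_R t g

/-- Dynkin's identity for the semigroup on `C²_c` (one derivative less than the interface requires;
used for `C²` Lyapunov functions). [folklore] -/
theorem semigroup_dynkin_two (hP : P.UniformlyConfining) (N : ℕ) (T_L T_R : ℝ) (hN : 0 < N) (hTL : 0 ≤ T_L)
    (hTR : 0 ≤ T_R) {f : PhaseSpace N → ℝ} (hf : ContDiff ℝ 2 f) (hf' : HasCompactSupport f) (t : ℝ≥0)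
    (z : PhaseSpace N) :
    (hP.semigroup N T_L T_R hN hTL hTR).act t f z - f z =
      ∫ s in (0 : ℝ)..(t : ℝ),
        (hP.semigroup N T_L T_R hN hTL hTR).act s.toNNReal (P.generator N T_L T_R f) z :=
  hP.langevinKernel_dynkin N T_L T_R hN hTL hTR hf hf' t z

end UniformlyConfining

end SiteChain

end Literature.MathematicalPhysics.KineticTheory.HeatConduction
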